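import Literature.Probability.RandomPlanarGeometry.HexSAWStripSurfaceWidthTwo
import Literature.Probability.RandomPlanarGeometry.HexSAWStripSurfaceThresholdClasses
import Literature.Probability.RandomPlanarGeometry.HexSAWStripSurfaceMonotone
import HarnessLib

/-!
# The width-two arch class has the same threshold: `A_2(x_c; y)` is bounded iff `y < y_2 = (10 + 8√2)/7`

Topic `Literature/Probability/RandomPlanarGeometry` (continues `HexSAWStripSurfaceWidthTwo.lean` — `HV.stripYT_two : y_2 = (10+8√2)/7`,
the `y`-weighted weave transfer sums `W2.wsumY` with their Perron bound at `W2.yTwo` — and `HexSAWStripSurfaceThresholdClasses.lean`: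
below `y_T` the arch class `L ↦ A_{T,L}(x_c; y)` is bounded, `HV.bddAbove_stripGFy_alpha_of_lt_stripYT`).  Source frame:
BBdGDCG14 (arXiv:1109.0358v5) §3.2 Corollary 8 (p. 12): "The series (in y) A_T(x_c, y), B_T(x_c, y) and C_T(x_c, y) have radius
of convergence y_T" — the COMMON-RADIUS clause, here in full for T = 2 at the level of the lane's boundedness sets.

## What is proved (lane «pcv-sawmu», a-p2 g9)

* `W2.asumY` — the `y`-weighted `α`-family sum; `W2.asumY_le_stripGFy_alpha` (injectivity of the families);
* `W2.wsumY_succ_ge_bot` — Perron bound for the end weight `1_⊥` at `y_2` (`M(y_2)·1_⊥ ≥ x³·u`), so the arch weave sums grow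
  linearly; `W2.asumY_yTwo_ge`;
* **`not_bddAbove_stripGFy_two_alpha_yTwo`** — at `y_2` the arch class of `S_2` is unbounded;
* **`bddAbove_stripGFy_two_alpha_iff`** — for `y ≥ 0`: `L ↦ A_{2,L}(x_c; y)` bounded ↔ `y < (10 + 8√2)/7` ↔ `L ↦ B_{2,L}(x_c; y)`
  bounded: the arch and bridge classes of the width-two strip share the threshold `y_2` EXACTLY (both halves);
* with the monotone thresholds of `HexSAWStripSurfaceMonotone.lean`: **`stripYT_add_two_le`** — `y_T ≤ y_2 = (10 + 8√2)/7` for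
  every `T ≥ 2` (sharpening the capstone's `y_T ≤ 2 + √2`), `stripYT_add_two_lt_stripYT_one` (`y_T < y_1`, `T ≥ 2`), and
  **`not_bddAbove_stripGFy_beta_of_lt`** — for `T ≥ 2` and `y > (10 + 8√2)/7` the critical weighted bridge class of `S_T` is
  unbounded (the zig-zag bound `y > 2 + √2` of `HexSAWStripSurfaceZigzag.lean` improved to `y > 3.0448…` from width two on).

Status in print: the common-radius clause is printed for every T via growth rates; here the T = 2 instance at x = x_c is
obtained from the solved strip (lane corollary; label = lit's call).
-/

noncomputable section

open Finset Filter Topology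

namespace Literature.Probability.RandomPlanarGeometry.SAW.HV

namespace W2

/-- Words in `bwords n` have length `n`. [folklore] -/
private theorem length_of_mem_bwords_arch {n : ℕ} {l : List Bool} (h : l ∈ bwords n) : l.length = n := by
  induction n generalizing l with
  | zero => simp [bwords] at h; subst h; rfl
  | succ n ih =>
    simp only [bwords, Finset.mem_union, Finset.mem_map, Function.Embedding.coeFn_mk] at h
    rcases h with ⟨l', hl', rfl⟩ | ⟨l', hl', rfl⟩ <;> simp [ih hl']

/-- **The `y`-weighted `α`-family sum** `Σ_{q ∈ paramsA N} x^{|fw q|} y^{c(fw q)}`. [cite: BeatonBousquetMelouDeGierDuminilCopinGuttmann2014, §2, eq. (10) (arXiv v5 p. 6: A_{T,L}(x;y)); lane: width two] -/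
def asumY (x y : ℝ) (N : ℕ) : ℝ := ∑ q ∈ paramsA N, x ^ qlen q * y ^ qcon q

/-- Parameters in `paramsA N` have side `s = ±1`. [cite: DuminilCopinSmirnov2012, §3 (Fig. 3: the symmetry of S_{T,L})] -/
theorem fst_eq_of_mem_paramsA {N : ℕ} {q : Param} (hq : q ∈ paramsA N) : q.1 = 1 ∨ q.1 = -1 := by
  obtain ⟨s, left, l, right⟩ := q
  simp only [paramsA, paramsW, signs, Finset.mem_filter, Finset.mem_product, Finset.mem_insert, Finset.mem_singleton] at hq
  exact hq.1.1

/-- **`asumY ≤ A_{2,2N}(x_c; y)`** (`y ≥ 0`): the `α`-family walks are distinct arches of `S_{2,2N}` with the computed contacts.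
[cite: BeatonBousquetMelouDeGierDuminilCopinGuttmann2014, §2, eq. (10) (arXiv v5 p. 6: A_{T,L}(x;y)); lane: width two] -/
theorem asumY_le_stripGFy_alpha {y : ℝ} (hy : 0 ≤ y) (N : ℕ) :
    asumY hexCriticalFugacity y N ≤ stripGFy 2 (2 * N) IsAlphaDart y := by
  have hx : 0 ≤ hexCriticalFugacity := hexCriticalFugacity_pos_lt_one.1.le
  have h1 : asumY hexCriticalFugacity y N =
      ∑ P ∈ (paramsA N).image fw, hexCriticalFugacity ^ mwLen P * y ^ surfContacts 2 P := by
    rw [asumY, Finset.sum_image (fw_injOn_paramsA N)]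
    refine Finset.sum_congr rfl fun q hq => ?_
    rw [surfContacts_fw (fst_eq_of_mem_paramsA hq), fw, mwLen_famWalk, qlen]
  rw [h1, stripGFy]
  exact Finset.sum_le_sum_of_subset_of_nonneg (Finset.image_subset_iff.2 fun q hq => fw_mem_alpha hq)
    fun P _ _ => mul_nonneg (pow_nonneg hx _) (pow_nonneg hy _)

/-- **Perron bound for the end weight `1_⊥` at the critical `y`**: with `y = (1 − x²)/(x²(1 − x² + x⁴))` and
`u = (x³y, 1 − x²)`, `M(y)·1_⊥ = (x², x³) ≥ x³·u`, hence `W_{n+1}(1_⊥) ≥ x³·u` for all `n` (the weave sums ending on the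
BOTTOM rail also grow linearly). [cite: BeatonBousquetMelouDeGierDuminilCopinGuttmann2014, Corollary 8 (arXiv v5 p. 12: y_T as the common radius); lane: width-two transfer bound] -/
theorem wsumY_succ_ge_bot {x : ℝ} (hx0 : 0 < x) (hx1 : x < 1) (n : ℕ) :
    x ^ 3 * (x ^ 3 * ((1 - x ^ 2) / (x ^ 2 * (1 - x ^ 2 + x ^ 4)))) ≤
        wsumY x ((1 - x ^ 2) / (x ^ 2 * (1 - x ^ 2 + x ^ 4))) (fun c => if c then 0 else 1) (n + 1) false ∧
      x ^ 3 * (1 - x ^ 2) ≤ wsumY x ((1 - x ^ 2) / (x ^ 2 * (1 - x ^ 2 + x ^ 4))) (fun c => if c then 0 else 1) (n + 1) true := by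
  set y := (1 - x ^ 2) / (x ^ 2 * (1 - x ^ 2 + x ^ 4)) with hy
  have hq : 0 < 1 - x ^ 2 + x ^ 4 := by nlinarith [sq_nonneg (x ^ 2)]
  have hx2 : 0 < x ^ 2 := by positivity
  have hx21 : x ^ 2 < 1 := by nlinarith
  have hden : 0 < x ^ 2 * (1 - x ^ 2 + x ^ 4) := mul_pos hx2 hq
  have hy0 : 0 ≤ y := div_nonneg (by linarith) hden.le
  have hkey : y * (x ^ 2 * (1 - x ^ 2 + x ^ 4)) = 1 - x ^ 2 := div_mul_cancel₀ _ hden.ne'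
  -- `x⁴ y ≤ 1`: from `y x² (1 - x² + x⁴) = 1 - x²` and `x²(1 - x² + x⁴) ≥ x² (1 - x²) ≥ x⁴ (1 - x²)`… we use `x⁶ y ≤ x²`.
  have hx4y : x ^ 4 * y ≤ 1 := by
    rw [hy, mul_div_assoc', div_le_iff₀ hden]
    nlinarith [pow_nonneg hx0.le 4, pow_nonneg hx0.le 6, mul_nonneg (pow_nonneg hx0.le 4) hx2.le]
  have hx3y : 0 ≤ x ^ 3 * y := mul_nonneg (pow_nonneg hx0.le 3) hy0
  have hx2y : 0 ≤ x ^ 2 * y := mul_nonneg (pow_nonneg hx0.le 2) hy0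
  induction n with
  | zero =>
    simp only [zero_add, wsumY_succ, wsumY_zero, if_true, Bool.true_eq_false, if_false, Bool.false_eq_true, mul_zero,
      add_zero, mul_one]
    refine ⟨?_, by nlinarith [pow_nonneg hx0.le 3, pow_nonneg hx0.le 5]⟩
    -- `x³ · x³ y ≤ x²`, i.e. `x⁴ y ≤ 1` after cancelling `x²`
    have : x ^ 3 * (x ^ 3 * y) = x ^ 2 * (x ^ 4 * y) := by ring
    rw [this]
    calc x ^ 2 * (x ^ 4 * y) ≤ x ^ 2 * 1 := mul_le_mul_of_nonneg_left hx4y hx2.le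
      _ = x ^ 2 := mul_one _
  | succ n ih =>
    obtain ⟨ihb, iht⟩ := ih
    rw [wsumY_succ x y _ (n + 1) false, wsumY_succ x y _ (n + 1) true]
    simp only [if_true, Bool.true_eq_false, if_false]
    constructor
    · calc x ^ 3 * (x ^ 3 * y) = x ^ 2 * (x ^ 3 * (x ^ 3 * y)) + x ^ 3 * y * (x ^ 3 * (1 - x ^ 2)) := by ring
        _ ≤ x ^ 2 * wsumY x y (fun c => if c then 0 else 1) (n + 1) false +
            x ^ 3 * y * wsumY x y (fun c => if c then 0 else 1) (n + 1) true :=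
          add_le_add (mul_le_mul_of_nonneg_left ihb (pow_nonneg hx0.le 2)) (mul_le_mul_of_nonneg_left iht hx3y)
    · calc x ^ 3 * (1 - x ^ 2) = x ^ 3 * (x ^ 3 * (x ^ 3 * y)) + x ^ 2 * y * (x ^ 3 * (1 - x ^ 2)) := by
            nlinarith [hkey]
        _ ≤ x ^ 3 * wsumY x y (fun c => if c then 0 else 1) (n + 1) false +
            x ^ 2 * y * wsumY x y (fun c => if c then 0 else 1) (n + 1) true :=
          add_le_add (mul_le_mul_of_nonneg_left ihb (pow_nonneg hx0.le 3)) (mul_le_mul_of_nonneg_left iht hx2y)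

/-- **At `y_2` the `α`-family sums are unbounded**: `asumY x_c y_2 N ≥ x_c⁷ y_2 · N` (the sub-family: no excursions, side
`s = 1`, weave words ending on the bottom rail). [cite: BeatonBousquetMelouDeGierDuminilCopinGuttmann2014, Corollary 8 (arXiv v5 p. 12); lane: width two] -/
theorem asumY_yTwo_ge (N : ℕ) : hexCriticalFugacity ^ 7 * yTwo * N ≤ asumY hexCriticalFugacity yTwo N := by
  set x := hexCriticalFugacity with hxdef
  have hx := hexCriticalFugacity_pos_lt_one
  have hx0 : 0 ≤ x := hx.1.le
  have hy0 : 0 ≤ yTwo := div_nonneg (by nlinarith [hx.1, hx.2]) yTwo_den_pos.le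
  -- the sub-family S = {(1, none, l, none) : l ∈ wordsN N, wend ⊥ l = ⊥} ⊆ paramsA N
  set emb : List Bool → Param := fun l => ((1 : ℤ), none, l, none) with hemb
  have hembinj : Function.Injective emb := fun l l' h => by
    simp only [hemb, Prod.mk.injEq] at h; exact h.2.2.1
  set S := ((wordsN N).filter fun l => wend false l = false).image emb with hS
  have hsub : S ⊆ paramsA N := by
    intro q hq
    rw [hS, Finset.mem_image] at hq
    obtain ⟨l, hl, rfl⟩ := hq
    rw [Finset.mem_filter] at hl
    rw [paramsA, Finset.mem_filter]
    refine ⟨Finset.mem_product.2 ⟨by simp [hemb, signs], Finset.mem_product.2 ⟨Finset.none_mem_insertNone,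
      Finset.mem_product.2 ⟨hl.1, Finset.none_mem_insertNone⟩⟩⟩, ?_⟩
    simp [qrail, frail, hemb, hl.2]
  have hterm : ∀ n, x ^ 3 * (x ^ 3 * yTwo) ≤ wsumY x yTwo (fun c => if c then 0 else 1) (n + 1) false := fun n =>
    (wsumY_succ_ge_bot hx.1 hx.2 n).1
  -- the sum over S
  have hsumS : ∑ q ∈ S, x ^ qlen q * yTwo ^ qcon q =
      x * ∑ n ∈ Finset.range N, wsumY x yTwo (fun c => if c then 0 else 1) (n + 1) false := by
    rw [hS, Finset.sum_image (hembinj.injOn), Finset.sum_filter, Finset.mul_sum, wordsN, Finset.sum_biUnion]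
    · refine Finset.sum_congr rfl fun n _ => ?_
      rw [wsumY, Finset.mul_sum]
      refine Finset.sum_congr rfl fun l _ => ?_
      simp only [hemb, qlen, elen, qcon, Option.elim_none, Option.isSome_none, add_zero, List.count, zero_add]
      cases h : wend false l
      · simp only [if_true, Bool.false_eq_true, if_false, mul_one, pow_add, pow_one]; ring
      · simp
    · intro n _ m _ hnm
      rw [Function.onFun, Finset.disjoint_left]
      intro l h1 h2
      exact hnm (by have := length_of_mem_bwords_arch h1; have := length_of_mem_bwords_arch h2; omega)
  have hnn : ∀ q ∈ paramsA N, 0 ≤ x ^ qlen q * yTwo ^ qcon q := fun q _ => mul_nonneg (pow_nonneg hx0 _) (pow_nonneg hy0 _)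
  calc x ^ 7 * yTwo * N = x * ((N : ℝ) * (x ^ 3 * (x ^ 3 * yTwo))) := by ring
    _ ≤ x * ∑ n ∈ Finset.range N, wsumY x yTwo (fun c => if c then 0 else 1) (n + 1) false := by
        refine mul_le_mul_of_nonneg_left ?_ hx0
        calc (N : ℝ) * (x ^ 3 * (x ^ 3 * yTwo)) = ∑ _n ∈ Finset.range N, x ^ 3 * (x ^ 3 * yTwo) := by
              rw [Finset.sum_const, Finset.card_range]; ring
          _ ≤ _ := Finset.sum_le_sum fun n _ => hterm n
    _ = ∑ q ∈ S, x ^ qlen q * yTwo ^ qcon q := hsumS.symm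
    _ ≤ asumY x yTwo N := Finset.sum_le_sum_of_subset_of_nonneg hsub fun q hq _ => hnn q hq

end W2

open W2 in
/-- **At `y_2` the arch class of `S_2` is unbounded.** [cite: BeatonBousquetMelouDeGierDuminilCopinGuttmann2014, Corollary 8 (arXiv v5 p. 12: A_T(x_c;y) has radius y_T); lane: the instance T = 2 with the exact value] -/
theorem not_bddAbove_stripGFy_two_alpha_yTwo : ¬ BddAbove (Set.range fun L : ℕ => stripGFy 2 L IsAlphaDart yTwo) := by
  rintro ⟨K, hK⟩
  have hx := hexCriticalFugacity_pos_lt_one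
  have hy0 : 0 ≤ yTwo := div_nonneg (by nlinarith [hx.1, hx.2]) yTwo_den_pos.le
  have hy1 : 0 < yTwo := div_pos (by nlinarith [hx.1, hx.2]) yTwo_den_pos
  have hc : 0 < hexCriticalFugacity ^ 7 * yTwo := mul_pos (pow_pos hx.1 7) hy1
  obtain ⟨N, hN⟩ := exists_nat_gt (K / (hexCriticalFugacity ^ 7 * yTwo))
  have h1 := asumY_yTwo_ge N
  have h2 := (asumY_le_stripGFy_alpha hy0 N).trans (hK ⟨2 * N, rfl⟩)
  rw [div_lt_iff₀ hc] at hN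
  nlinarith

open W2 in
/-- **The arch and bridge classes of the width-two strip share the threshold `y_2 = (10 + 8√2)/7` exactly**: for `y ≥ 0`,
`L ↦ A_{2,L}(x_c; y)` is bounded iff `y < (10 + 8√2)/7` (iff `L ↦ B_{2,L}(x_c; y)` is bounded) — the T = 2 instance of
Corollary 8's common-radius clause, both halves. [cite: BeatonBousquetMelouDeGierDuminilCopinGuttmann2014, Corollary 8 (arXiv v5 p. 12: "The series (in y) A_T(x_c;y), B_T(x_c;y) and C_T(x_c;y) have radius of convergence y_T"); lane: T = 2, exact] -/
theorem bddAbove_stripGFy_two_alpha_iff {y : ℝ} (hy : 0 ≤ y) :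
    BddAbove (Set.range fun L : ℕ => stripGFy 2 L IsAlphaDart y) ↔ y < (10 + 8 * Real.sqrt 2) / 7 := by
  constructor
  · intro hb
    by_contra hge
    push Not at hge
    rw [← yTwo_eq] at hge
    exact not_bddAbove_stripGFy_two_alpha_yTwo (bddAbove_stripGFy_of_le 2 IsAlphaDart
      (div_nonneg (by nlinarith [hexCriticalFugacity_pos_lt_one.1, hexCriticalFugacity_pos_lt_one.2]) yTwo_den_pos.le) hge hb)
  · intro hlt
    rw [← stripYT_two] at hlt
    exact bddAbove_stripGFy_alpha_of_lt_stripYT (by norm_num) hy hlt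

/-! ### Consequences for every `T ≥ 2` (with the monotone thresholds) -/

/-- **`y_T ≤ y_2 = (10 + 8√2)/7` for every `T ≥ 2`** (stated for `T + 2`): the thresholds are non-increasing
(`antitone_stripYT_succ`) and `y_2` is exact. [cite: BeatonBousquetMelouDeGierDuminilCopinGuttmann2014, Corollary 8 (arXiv v5 p. 12: "y_T decreases to the critical fugacity y_c"); lane: the explicit bound from width two on] -/
theorem stripYT_add_two_le (T : ℕ) : stripYT (T + 2) ≤ (10 + 8 * Real.sqrt 2) / 7 := by
  rw [← stripYT_two]
  exact antitone_stripYT_succ (show 1 ≤ T + 1 by omega)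

/-- **`y_T < y_1` for every `T ≥ 2`** (stated for `T + 2`). [cite: BeatonBousquetMelouDeGierDuminilCopinGuttmann2014, Corollary 8 (arXiv v5 p. 12; proof p. 13: "y_{T+1} < y_T"); lane: strict from width two on, via the exact y_2] -/
theorem stripYT_add_two_lt_stripYT_one (T : ℕ) : stripYT (T + 2) < stripYT 1 :=
  (stripYT_add_two_le T).trans_lt (by rw [← stripYT_two]; exact stripYT_two_lt_stripYT_one)

/-- **For `T ≥ 2` and `y > (10 + 8√2)/7` the critical weighted bridge class of `S_T` is unbounded** (sharpening the zig-zag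
threshold `2 + √2` of `HexSAWStripSurfaceZigzag.lean` from width two on). [cite: BeatonBousquetMelouDeGierDuminilCopinGuttmann2014, Corollary 8 (arXiv v5 p. 12: y_T is the radius of B_T(x_c;y)); lane: explicit from width two on] -/
theorem not_bddAbove_stripGFy_beta_of_lt {T : ℕ} (hT : 2 ≤ T) {y : ℝ} (hy : (10 + 8 * Real.sqrt 2) / 7 < y) :
    ¬ BddAbove (Set.range fun L : ℕ => stripGFy T L (IsBetaDart T) y) := by
  intro hb
  obtain ⟨T', rfl⟩ : ∃ T', T = T' + 2 := ⟨T - 2, by omega⟩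
  have hy0 : 0 ≤ y := le_trans (by positivity) hy.le
  have h1 : y ≤ stripYT (T' + 2) := le_stripYT (by omega) hy0 hb
  linarith [stripYT_add_two_le T']

open W2 in
/-- The bridge class, for comparison: bounded iff `y < y_2` (`y ≥ 0`). [cite: BeatonBousquetMelouDeGierDuminilCopinGuttmann2014, Corollary 8 (arXiv v5 p. 12); lane: T = 2, exact] -/
theorem bddAbove_stripGFy_two_beta_iff {y : ℝ} (hy : 0 ≤ y) :
    BddAbove (Set.range fun L : ℕ => stripGFy 2 L (IsBetaDart 2) y) ↔ y < (10 + 8 * Real.sqrt 2) / 7 := by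
  constructor
  · intro hb
    by_contra hge
    push Not at hge
    rw [← yTwo_eq] at hge
    exact not_bddAbove_stripGFy_two_yTwo (bddAbove_stripGFy_of_le 2 (IsBetaDart 2)
      (div_nonneg (by nlinarith [hexCriticalFugacity_pos_lt_one.1, hexCriticalFugacity_pos_lt_one.2]) yTwo_den_pos.le) hge hb)
  · intro hlt
    rw [← yTwo_eq] at hlt
    exact (mem_stripBddSet_two_of_lt hy hlt).2

end Literature.Probability.RandomPlanarGeometry.SAW.HV
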